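import Mathlib
import HarnessLib
import Summits.AtomisticToContinuum.BoseEinsteinCondensation.Theses.BECSwapAffinity

/-!
# Refutation of `BECSwapAffinity.SwapJensen` (stmt-AtomisticToContinuum-3980)

`Summit.AtomisticToContinuum.BoseEinsteinCondensation.Theses.BECSwapAffinity.SwapJensen` quantifies
over ALL real constants `C` (only `0 < θ` is assumed) and concludes
`ENNReal.ofReal (θ * exp (-(C / (2θ)))) ≤ swap purity`. For one particle (`n = 0`, `N = 1`) the
coordinate swap `Function.update Z.1 0 (Z.2 0) = Z.2` is the identity on `Config 1`, so the swapped
density `q` equals `p`: the (truncated, `ENNReal.ofReal`) accessible swap entropy is `0 ≤ ofReal C`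
for EVERY `C`, the accessible mass is `∫∫ p = 1`, and the swap purity is exactly `1` — for every
normalised one-particle trial state. With `θ = 1`, `C = -2` the conclusion reads `e ≤ 1`:
contradiction. Witness state: the normalised smooth bump in the unit box (`L = 1`), real and
nonnegative, a genuine `TrialState 1 1` (same construction as
`Literature.MathematicalPhysics.QuantumManyBody.BoseGas.TrialState.nonempty_one`).

The intended statement needs the side condition `0 ≤ C` (or `max C 0` in the exponent); for
`C ≥ 0` the truncated-Jensen argument of the item's docstring is untouched. [folklore]
-/

noncomputable section

open MeasureTheory Metric
open scoped ENNReal NNReal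

namespace Summit.AtomisticToContinuum.BoseEinsteinCondensation.Theorems

open Literature.MathematicalPhysics.QuantumManyBody.BoseGas

/-- Refutes `BECSwapAffinity.SwapJensen`: the item quantifies over all real `C` (no `0 ≤ C`); at
`n = 0` (one particle) the swap `x₀ ↔ y₀` is the identity, so for any normalised real nonnegative
one-particle trial state both hypotheses hold with `θ = 1`, `C = -2` (mass `= 1`, truncated swap
entropy `= 0`) while the swap purity is `1 < e = θ·exp(-C/(2θ))`. Witness: the normalised
`ContDiffBump` state in the unit box. [folklore] -/
theorem BECSwapAffinitySwapJensen_refuted :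
    ¬ Summit.AtomisticToContinuum.BoseEinsteinCondensation.Theses.BECSwapAffinity.SwapJensen := by
  intro h
  /- 1. For one particle the swap is the identity. -/
  have update_fin_one : ∀ X Y : Config 1, Function.update X 0 (Y 0) = Y := by
    intro X Y
    funext j
    have hj : j = 0 := Subsingleton.elim _ _
    subst hj
    simp
  have swap_eq : ∀ (φ : Config 1 → ℂ) (Z : Config 1 × Config 1),
      ‖φ (Function.update Z.1 0 (Z.2 0))‖ ^ 2 * ‖φ (Function.update Z.2 0 (Z.1 0))‖ ^ 2 =
        ‖φ Z.1‖ ^ 2 * ‖φ Z.2‖ ^ 2 := by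
    intro φ Z
    rw [update_fin_one, update_fin_one, mul_comm]
  have ofReal_norm_sq : ∀ z : ℂ, ENNReal.ofReal (‖z‖ ^ 2) = (‖z‖₊ : ℝ≥0∞) ^ 2 := by
    intro z
    rw [ENNReal.ofReal_pow (norm_nonneg _), ofReal_norm, enorm_eq_nnnorm]
  /- 2. Generic facts for every normalised one-particle trial state in the unit box. -/
  have lintegral_p : ∀ Ψ : TrialState 1 1,
      ∫⁻ Z : Config 1 × Config 1, ENNReal.ofReal (‖Ψ.ψ Z.1‖ ^ 2 * ‖Ψ.ψ Z.2‖ ^ 2) = 1 := by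
    intro Ψ
    have hmeas : AEMeasurable (fun X : Config 1 => (‖Ψ.ψ X‖₊ : ℝ≥0∞) ^ 2) volume :=
      ((Ψ.contDiff.continuous).measurable.nnnorm.coe_nnreal_ennreal.pow_const 2).aemeasurable
    have h1 : ∀ Z : Config 1 × Config 1,
        ENNReal.ofReal (‖Ψ.ψ Z.1‖ ^ 2 * ‖Ψ.ψ Z.2‖ ^ 2) =
          (‖Ψ.ψ Z.1‖₊ : ℝ≥0∞) ^ 2 * (‖Ψ.ψ Z.2‖₊ : ℝ≥0∞) ^ 2 := by
      intro Z
      rw [ENNReal.ofReal_mul (sq_nonneg _), ofReal_norm_sq, ofReal_norm_sq]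
    simp_rw [h1]
    rw [MeasureTheory.Measure.volume_eq_prod, lintegral_prod_mul hmeas hmeas, Ψ.norm_eq, one_mul]
  have measurableSet_p_ne : ∀ Ψ : TrialState 1 1,
      MeasurableSet {Z : Config 1 × Config 1 | ‖Ψ.ψ Z.1‖ ^ 2 * ‖Ψ.ψ Z.2‖ ^ 2 ≠ 0} := by
    intro Ψ
    have hc : Continuous fun Z : Config 1 × Config 1 => ‖Ψ.ψ Z.1‖ ^ 2 * ‖Ψ.ψ Z.2‖ ^ 2 := by
      have h := Ψ.contDiff.continuous
      fun_prop
    exact (isOpen_ne_fun hc continuous_const).measurableSet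
  have setLIntegral_p : ∀ Ψ : TrialState 1 1,
      ∫⁻ Z in {Z : Config 1 × Config 1 | ‖Ψ.ψ Z.1‖ ^ 2 * ‖Ψ.ψ Z.2‖ ^ 2 ≠ 0},
        ENNReal.ofReal (‖Ψ.ψ Z.1‖ ^ 2 * ‖Ψ.ψ Z.2‖ ^ 2) = 1 := by
    intro Ψ
    have hS := measurableSet_p_ne Ψ
    have hcompl : ∫⁻ Z in {Z : Config 1 × Config 1 | ‖Ψ.ψ Z.1‖ ^ 2 * ‖Ψ.ψ Z.2‖ ^ 2 ≠ 0}ᶜ,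
        ENNReal.ofReal (‖Ψ.ψ Z.1‖ ^ 2 * ‖Ψ.ψ Z.2‖ ^ 2) = 0 := by
      rw [setLIntegral_congr_fun hS.compl (g := fun _ => 0) (fun Z hZ => ?_)]
      · simp
      · simp only [Set.mem_compl_iff, Set.mem_setOf_eq, not_not] at hZ
        rw [hZ, ENNReal.ofReal_zero]
    have := lintegral_add_compl (μ := volume)
      (fun Z : Config 1 × Config 1 => ENNReal.ofReal (‖Ψ.ψ Z.1‖ ^ 2 * ‖Ψ.ψ Z.2‖ ^ 2)) hS
    rw [hcompl, add_zero, lintegral_p] at this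
    exact this
  have integral_norm_sq : ∀ Ψ : TrialState 1 1, ∫ X : Config 1, ‖Ψ.ψ X‖ ^ 2 = 1 := by
    intro Ψ
    rw [integral_eq_lintegral_of_nonneg_ae (Filter.Eventually.of_forall fun X => sq_nonneg _)
      ((Ψ.contDiff.continuous).norm.pow 2).aestronglyMeasurable]
    simp_rw [ofReal_norm_sq]
    rw [Ψ.norm_eq, ENNReal.toReal_one]
  have integral_norm_sq_space : ∀ Ψ : TrialState 1 1,
      ∫ x : Space, ‖Ψ.ψ (fun _ => x)‖ ^ 2 = 1 := by
    intro Ψ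
    have hmp : MeasurePreserving (MeasurableEquiv.funUnique (Fin 1) Space).symm volume volume :=
      (volume_preserving_funUnique (Fin 1) Space).symm _
    have h := hmp.integral_comp' (g := fun X : Config 1 => ‖Ψ.ψ X‖ ^ 2)
    have hsymm : ∀ x : Space,
        ((MeasurableEquiv.funUnique (Fin 1) Space).symm x : Config 1) = fun _ => x :=
      fun x => rfl
    simp_rw [hsymm] at h
    rw [h, integral_norm_sq]
  have purity_eq_one : ∀ Ψ : TrialState 1 1,
      ∫⁻ P : Config 0 × Config 0, (‖∫ x, Ψ.ψ (Matrix.vecCons x P.1) *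
        (starRingEnd ℂ) (Ψ.ψ (Matrix.vecCons x P.2))‖₊ : ℝ≥0∞) ^ 2 = 1 := by
    intro Ψ
    have hinner : ∀ P : Config 0 × Config 0,
        ∫ x, Ψ.ψ (Matrix.vecCons x P.1) * (starRingEnd ℂ) (Ψ.ψ (Matrix.vecCons x P.2)) = 1 := by
      intro P
      have h1 : ∀ x : Space,
          Ψ.ψ (Matrix.vecCons x P.1) * (starRingEnd ℂ) (Ψ.ψ (Matrix.vecCons x P.2)) =
            ((‖Ψ.ψ (fun _ => x)‖ ^ 2 : ℝ) : ℂ) := by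
        intro x
        rw [Matrix.cons_fin_one x P.1, Matrix.cons_fin_one x P.2, Complex.mul_conj,
          Complex.normSq_eq_norm_sq, Complex.ofReal_pow]
      simp_rw [h1]
      rw [integral_complex_ofReal, integral_norm_sq_space, Complex.ofReal_one]
    simp_rw [hinner, nnnorm_one, ENNReal.coe_one, one_pow]
    have h0 : (volume : Measure (Config 0)) Set.univ = 1 := by
      rw [MeasureTheory.volume_pi, MeasureTheory.Measure.pi_univ]
      simp
    rw [lintegral_one, MeasureTheory.Measure.volume_eq_prod, ← Set.univ_prod_univ,
      MeasureTheory.Measure.prod_prod, h0, one_mul]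
  /- 3. A real nonnegative one-particle trial state in the unit box: a normalised smooth bump
     (as in `TrialState.nonempty_one`). -/
  have hex : ∃ Ψ : TrialState 1 1, ∀ X, Ψ.ψ X = (‖Ψ.ψ X‖ : ℂ) := by
    have hL : (0 : ℝ) < 1 := one_pos
    let c : Config 1 := fun _ => WithLp.toLp 2 (fun _ : Fin 3 => (1 : ℝ) / 2)
    let f : ContDiffBump c := ⟨1 / 8, 1 / 4, by norm_num, by norm_num⟩
    set A : ℝ≥0∞ := ∫⁻ X, (‖f X‖₊ : ℝ≥0∞) ^ 2 with hA
    have hmeas : Measurable (fun X => (‖f X‖₊ : ℝ≥0∞) ^ 2) :=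
      (f.continuous.measurable.nnnorm.coe_nnreal_ennreal).pow_const 2
    have hAtop : A ≠ ⊤ := by
      have hint : Integrable (fun X => f X ^ 2) volume :=
        (f.continuous.pow 2).integrable_of_hasCompactSupport
          (f.hasCompactSupport.mul_left (f' := f))
      have := hint.2
      rw [HasFiniteIntegral] at this
      refine ne_top_of_le_ne_top this.ne (le_of_eq ?_)
      refine lintegral_congr fun X => ?_
      rw [enorm_pow]
      rfl
    have hA0 : A ≠ 0 := by
      have h1 : volume (closedBall c f.rIn) ≤ A := by
        calc volume (closedBall c f.rIn) = ∫⁻ X in closedBall c f.rIn, 1 :=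
            (setLIntegral_one _).symm
          _ = ∫⁻ X in closedBall c f.rIn, (‖f X‖₊ : ℝ≥0∞) ^ 2 := by
              refine setLIntegral_congr_fun measurableSet_closedBall (fun X hX => ?_)
              rw [f.one_of_mem_closedBall hX]; simp
          _ ≤ A := setLIntegral_le_lintegral _ _
      have h2 : 0 < volume (closedBall c f.rIn) := measure_closedBall_pos volume c (by
        show (0 : ℝ) < 1 / 8; norm_num)
      exact (h2.trans_le h1).ne'
    let k : ℝ≥0 := NNReal.sqrt (A.toNNReal)⁻¹
    have hk : (k : ℝ≥0∞) ^ 2 * A = 1 := by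
      rw [← ENNReal.coe_pow, NNReal.sq_sqrt,
        ENNReal.coe_inv (ENNReal.toNNReal_ne_zero.2 ⟨hA0, hAtop⟩),
        ENNReal.coe_toNNReal hAtop, ENNReal.inv_mul_cancel hA0 hAtop]
    refine ⟨⟨fun X => (k : ℂ) * (f X : ℂ), ?_, ?_, ?_, ?_⟩, ?_⟩
    · exact contDiff_const.mul (Complex.ofRealCLM.contDiff.comp f.contDiff)
    · intro X hX
      suffices f X = 0 by simp [this]
      rw [← Function.notMem_support, f.support_eq]
      intro hball
      apply hX
      simp only [boxN, box, Set.mem_setOf_eq]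
      intro i j
      have h1 : dist (X i) (c i) < 1 / 4 := (dist_le_pi_dist X c i).trans_lt hball
      have h2 : dist (X i j) (1 / 2) < 1 / 4 := (PiLp.dist_apply_le (X i) (c i) j).trans_lt h1
      rw [Real.dist_eq, abs_lt] at h2
      constructor <;> linarith [h2.1, h2.2]
    · intro σ X
      rw [Subsingleton.elim σ 1, Equiv.Perm.coe_one, Function.comp_id]
    · have : ∀ X, (‖(k : ℂ) * (f X : ℂ)‖₊ : ℝ≥0∞) ^ 2 = (k : ℝ≥0∞) ^ 2 * (‖f X‖₊ : ℝ≥0∞) ^ 2 := by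
        intro X
        rw [nnnorm_mul, ENNReal.coe_mul, mul_pow]
        congr 2
        · simp
        · rw [Complex.nnnorm_real]
      simp_rw [this]
      rw [lintegral_const_mul _ hmeas, hk]
    · intro X
      show (k : ℂ) * (f X : ℂ) = (‖(k : ℂ) * (f X : ℂ)‖ : ℂ)
      have hkf : 0 ≤ (k : ℝ) * f X := mul_nonneg k.2 (f.nonneg)
      rw [show (k : ℂ) * (f X : ℂ) = (((k : ℝ) * f X : ℝ) : ℂ) by push_cast; rfl,
        Complex.norm_real, Real.norm_eq_abs, abs_of_nonneg hkf]
  /- 4. The contradiction at `n = 0`, `L = 1`, `θ = 1`, `C = -2`. -/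
  obtain ⟨Ψ, hreal⟩ := hex
  have key := h 0 1 Ψ hreal 1 (-2) one_pos
  have hmass : ENNReal.ofReal 1 ≤ ∫⁻ Z in {Z : Config 1 × Config 1 |
      ‖Ψ.ψ (Function.update Z.1 0 (Z.2 0))‖ ^ 2 * ‖Ψ.ψ (Function.update Z.2 0 (Z.1 0))‖ ^ 2 ≠ 0},
      ENNReal.ofReal (‖Ψ.ψ Z.1‖ ^ 2 * ‖Ψ.ψ Z.2‖ ^ 2) := by
    simp only [swap_eq]
    rw [setLIntegral_p, ENNReal.ofReal_one]
  have hent : (∫⁻ Z in {Z : Config 1 × Config 1 |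
      ‖Ψ.ψ (Function.update Z.1 0 (Z.2 0))‖ ^ 2 * ‖Ψ.ψ (Function.update Z.2 0 (Z.1 0))‖ ^ 2 ≠ 0},
      ENNReal.ofReal (‖Ψ.ψ Z.1‖ ^ 2 * ‖Ψ.ψ Z.2‖ ^ 2 *
        (Real.log (‖Ψ.ψ Z.1‖ ^ 2 * ‖Ψ.ψ Z.2‖ ^ 2) -
          Real.log (‖Ψ.ψ (Function.update Z.1 0 (Z.2 0))‖ ^ 2 *
            ‖Ψ.ψ (Function.update Z.2 0 (Z.1 0))‖ ^ 2)))) ≤ ENNReal.ofReal (-2) := by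
    simp only [swap_eq, sub_self, mul_zero, ENNReal.ofReal_zero, lintegral_zero]
    exact zero_le
  have hc := key hmass hent
  rw [purity_eq_one Ψ] at hc
  have h1 : 1 * Real.exp (-(-2 / (2 * 1))) ≤ 1 := ENNReal.ofReal_le_one.1 hc
  have h2 : Real.exp 1 ≤ 1 := by
    have : (-(-2 / (2 * 1)) : ℝ) = 1 := by norm_num
    rw [this, one_mul] at h1
    exact h1
  linarith [Real.add_one_le_exp (1 : ℝ)]

end Summit.AtomisticToContinuum.BoseEinsteinCondensation.Theorems
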